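import Summits.Ventures.DiscreteObjects.PP12.OrderThirteenShapeCells

/-!
# PP(12), order-13 cell: well-formedness of the kernel search data, the key of a pair under the invariant, and SOUNDNESS of the shape-level search
Framing: lottery ticket; floor = certified bounds/negative ranges.

Cell pub-namedobj (venture DiscreteObjects), target (M). Text: designs gen 20 (`OrderThirteenShapeSearchWF` + `…SearchPairs` + `…SearchSound`, each verified rc 0);
merged into ONE module by designs gen 22 for the gate's 400-line rule and the farm's build depth (whitespace/structure only: proofs re-laid on single lines with
explicit `;` sequencing, bullets as parenthesised blocks, `calc` chains as `Eq.trans`; every declaration, statement and proof step unchanged; pub-namedobj-designs-g22/code/omsplit).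
(1) `wfFrom M 0 cells` — the Boolean well-formedness of the per-class `Cell` literals of `Shape13.search` relative to the orbit-matrix literal `M`, evaluation
lemmas of the search primitives, the invariant (`InvA`, `Opens`, `InvD`); (2) under `InvA` the key `pairKey A cols` of a well-formed row/column pair is the prime
product of the canonical tiles of its active shared lines (`pairKey_row`, `pairKey_col`), `perm_tmask_of_prodP_eq` (unique factorisation); (3) **`searchK_sound`** /
`noLift_of_searchK` / `noLift_of_search`: a valid `D : LiftData 11 13` with orbit matrix `M` refutes a successful run (children survive by `row_compat`/`col_compat`,
pairs pack by `row_pack`/`col_pack`, an INFEASIBLE table hit contradicts `packDFS_of_packP`); `LeafSound`, `repsOf`, `wlogOK`, `wlog_of_wlogOK`. No `sorry`, no new axioms.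
-/

set_option maxRecDepth 100000

namespace Summit.Ventures.DiscreteObjects.PP12

namespace Shape13

open LiftData

/-- entry `c = 11 s + t` of an orbit-matrix literal (3-bit fields) -/
def mAt (M c : ℕ) : ℕ := Nat.land (Nat.shiftRight M (3 * c)) 7
/-- the row of cell index `c` -/
def rowOf (c : ℕ) : Fin 11 := ⟨c / 11 % 11, Nat.mod_lt _ (by norm_num)⟩
/-- the column of cell index `c` -/
def colOf (c : ℕ) : Fin 11 := ⟨c % 11, Nat.mod_lt _ (by norm_num)⟩
/-- the row of a cell index below `121` -/
theorem rowOf_val {c : ℕ} (hc : c < 121) : (rowOf c : ℕ) = c / 11 := by show c / 11 % 11 = c / 11; exact Nat.mod_eq_of_lt (by omega)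
/-- a cell index is `11 · row + column` -/
theorem cix_eq {c : ℕ} (hc : c < 121) : 11 * (rowOf c : ℕ) + (colOf c : ℕ) = c := by rw [rowOf_val hc]; show 11 * (c / 11) + c % 11 = c; omega
/-- the orbit-matrix literal agrees with the orbit matrix of `D` -/
def MatOK (M : ℕ) (D : LiftData 11 13) : Prop := ∀ s t : Fin 11, mAt M (11 * s + t) = D.om s t
/-- reading an orbit-matrix entry by cell index -/
theorem MatOK.omC {M : ℕ} {D : LiftData 11 13} (hM : MatOK M D) {c : ℕ} (hc : c < 121) : D.om (rowOf c) (colOf c) = mAt M c := by rw [← hM, cix_eq hc]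
/-- different cells on a common row or column -/
def sameLine (c c' : ℕ) : Bool := !(Nat.beq c c') && (Nat.beq (c / 11) (c' / 11) || Nat.beq (c % 11) (c' % 11))
/-- the union of `cg <<< dof'` over the later cells on the line of `c` -/
def lineMask (cg c : ℕ) : List Cell → ℕ | [] => 0 | cl :: rest => Nat.lor (bif sameLine c cl.cix then Nat.shiftLeft cg cl.dof else 0) (lineMask cg c rest)
/-- the candidate list is the standard one, and each filter product is the line mask -/
def candsOK (m c nmul : ℕ) (rest : List Cell) (cands : List (ℕ × ℕ × ℕ)) : Bool := (cands == (idsOfSize m).map fun g => (2 ^ g, Nat.shiftLeft (g + 1) (5 * c), confl g)) && (idsOfSize m).all fun g => Nat.beq (confl g * nmul) (lineMask (confl g) c rest)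
/-- a ROW-pair column list: entries `(5 (11 s + t₂), 5 (11 s₂ + t₂))` with pairwise distinct `t₂` -/
def rowPairOK (s s2 : ℕ) : List (ℕ × ℕ) → List ℕ → Bool | [], _ => true | e :: es, seen => Nat.beq e.1 (5 * (11 * s + e.1 / 5 % 11)) && Nat.beq e.2 (5 * (11 * s2 + e.1 / 5 % 11)) && !(seen.elem (e.1 / 5 % 11)) && rowPairOK s s2 es ((e.1 / 5 % 11) :: seen)
/-- a COLUMN-pair row list: entries `(5 (11 s₂ + t), 5 (11 s₂ + t₂))` with pairwise distinct `s₂ < 11` -/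
def colPairOK (t t2 : ℕ) : List (ℕ × ℕ) → List ℕ → Bool | [], _ => true | e :: es, seen => Nat.blt (e.1 / 5 / 11) 11 && Nat.beq e.1 (5 * (11 * (e.1 / 5 / 11) + t)) && Nat.beq e.2 (5 * (11 * (e.1 / 5 / 11) + t2)) && !(seen.elem (e.1 / 5 / 11)) && colPairOK t t2 es ((e.1 / 5 / 11) :: seen)
/-- a pair through cell `c`: a row pair with some other row, or a column pair with some other column -/
def pairOK (c : ℕ) (cols : List (ℕ × ℕ)) : Bool := (List.range 11).any (fun s2 => !(Nat.beq s2 (c / 11)) && rowPairOK (c / 11) s2 cols []) || (List.range 11).any (fun t2 => !(Nat.beq t2 (c % 11)) && colPairOK (c % 11) t2 cols [])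
/-- one cell of the data, at position `i`, followed by `rest` -/
def cellOK (M : ℕ) (i : ℕ) (cl : Cell) (rest : List Cell) : Bool := Nat.blt cl.cix 121 && Nat.ble 2 (mAt M cl.cix) && Nat.ble (mAt M cl.cix) 4 && Nat.beq cl.dof (27 * i) && !((rest.map Cell.cix).elem cl.cix) && candsOK (mAt M cl.cix) cl.cix cl.nmul rest cl.cands && cl.echk.all (fun o => (rest.map Cell.dof).elem o) && cl.pairs.all (fun pr => pairOK cl.cix pr.1)
/-- **well-formedness of the cell data** from position `i` on (decided per class) -/
def wfFrom (M : ℕ) : ℕ → List Cell → Bool | _, [] => true | i, cl :: rest => cellOK M i cl rest && wfFrom M (i + 1) rest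
/-- if all children are refuted, so is the child of any present candidate -/
theorem children_child {cl : Cell} {k : ℕ → ℕ → Bool} {A D f : ℕ} {cand : ℕ × ℕ × ℕ} : ∀ {cs : List (ℕ × ℕ × ℕ)}, children cl k A D f cs = true → cand ∈ cs → Nat.beq (Nat.land f cand.1) 0 = false → child cl k A D cand = true | [], _, h, _ => absurd h (by simp) | c :: cs, h, hm, hp => (by simp only [children, Bool.and_eq_true] at h; rcases List.mem_cons.1 hm with rfl | hm; (have h1 := h.1; rw [hp] at h1; exact h1); (exact children_child h.2 hm hp))
/-- a bad pair is a table hit of some listed pair -/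
theorem badPair_true {A : ℕ} : ∀ {prs : List (List (ℕ × ℕ) × KT)}, badPair A prs = true → ∃ pr ∈ prs, KT.mem (pairKey A pr.1) pr.2 = true | [], h => (by simp [badPair] at h) | pr :: prs, h => (by simp only [badPair, Bool.or_eq_true] at h; rcases h with h | h; (exact ⟨pr, List.mem_cons_self .., h⟩); (obtain ⟨q, hq, h⟩ := badPair_true h; exact ⟨q, List.mem_cons_of_mem _ hq, h⟩))
/-- an emptiness flag is an empty listed domain -/
theorem anyEmpty_true {D : ℕ} : ∀ {os : List ℕ}, anyEmpty D os = true → ∃ o ∈ os, dAt D o = 0 | [], h => (by simp [anyEmpty] at h) | o :: os, h => (by simp only [anyEmpty, Bool.or_eq_true, beq_eq_decide, decide_eq_true_eq] at h; rcases h with h | h; (exact ⟨o, List.mem_cons_self .., h⟩); (obtain ⟨q, hq, h⟩ := anyEmpty_true h; exact ⟨q, List.mem_cons_of_mem _ hq, h⟩))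
/-- a key found in a verified tree has a witness satisfying the check -/
theorem KT.all_mem {p : ℕ → List ℕ → Bool} {x : ℕ} : ∀ {T : KT}, KT.all p T = true → KT.mem x T = true → ∃ w, p x w = true | KT.leaf, _, h => (by simp [KT.mem] at h) | KT.node l k w r, ha, h => (by simp only [KT.all, Bool.and_eq_true] at ha; unfold KT.mem at h; cases hlt : Nat.blt x k; (rw [hlt] at h; cases heq : Nat.beq x k; (rw [heq] at h; exact KT.all_mem ha.2.2 h); (rw [beq_eq_decide, decide_eq_true_eq] at heq; subst heq; exact ⟨w, ha.1⟩)); (rw [hlt] at h; exact KT.all_mem ha.2.1 h))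
/-- every pair tree of verified data verifies -/
theorem tablesOK_mem {cells : List Cell} (h : tablesOK cells = true) {cl : Cell} (hcl : cl ∈ cells) {pr : List (ℕ × ℕ) × KT} (hpr : pr ∈ cl.pairs) : infOK pr.2 = true := by induction cells with | nil => exact absurd hcl (by simp) | cons c rest ih => (simp only [tablesOK, Bool.and_eq_true, List.all_eq_true] at h; rcases List.mem_cons.1 hcl with rfl | hcl; (exact h.1 pr hpr); (exact ih h.2 hcl))
/-- the bits of a line mask come from a later cell on the line -/
theorem testBit_lineMask {cg c n : ℕ} : ∀ {rest : List Cell}, (lineMask cg c rest).testBit n = true → ∃ cl ∈ rest, sameLine c cl.cix = true ∧ cl.dof ≤ n ∧ cg.testBit (n - cl.dof) = true | [], h => (by simp [lineMask] at h) | cl :: rest, h => (by unfold lineMask at h; rw [lor_def, Nat.testBit_lor, Bool.or_eq_true] at h; rcases h with h | h; (cases hs : sameLine c cl.cix; (rw [hs] at h; simp at h); (rw [hs, cond_true, shiftLeft_def, Nat.testBit_shiftLeft, Bool.and_eq_true, decide_eq_true_eq] at h; exact ⟨cl, List.mem_cons_self .., hs, h.1, h.2⟩)); (obtain ⟨cl',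 h1, h2, h3, h4⟩ := testBit_lineMask h; exact ⟨cl', List.mem_cons_of_mem _ h1, h2, h3, h4⟩))
/-- `prodP` is the product of the primes -/
theorem prodP_eq (l : List ℕ) : prodP l = (l.map primeOf).prod := by induction l with | nil => rfl | cons a l ih => simp [prodP, ih]
/-- the domain offsets of well-formed data from position `i` are multiples of `27`, at least `27 i` -/
theorem wf_dof_ge {M : ℕ} : ∀ {i : ℕ} {cells : List Cell}, wfFrom M i cells = true → ∀ cl ∈ cells, 27 * i ≤ cl.dof ∧ 27 ∣ cl.dof | _, [], _, cl, h => absurd h (by simp) | i, c :: rest, h, cl, hcl => (by simp only [wfFrom, Bool.and_eq_true] at h; have hd : c.dof = 27 * i := (by have := h.1; simp only [cellOK, Bool.and_eq_true, beq_eq_decide, decide_eq_true_eq] at this; exact this.1.1.1.1.2); rcases List.mem_cons.1 hcl with rfl | hcl; (exact ⟨hd.ge, ⟨i, hd⟩⟩); (have := wf_dof_ge h.2 cl hcl; exact ⟨by omega, this.2⟩))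
/-- the domain offsets of well-formed data are injective -/
theorem wf_dof_inj {M : ℕ} : ∀ {i : ℕ} {cells : List Cell}, wfFrom M i cells = true → ∀ cl₁ ∈ cells, ∀ cl₂ ∈ cells, cl₁.dof = cl₂.dof → cl₁ = cl₂ | _, [], _, cl, h, _, _, _ => absurd h (by simp) | i, c :: rest, h, cl₁, h₁, cl₂, h₂, he => (by simp only [wfFrom, Bool.and_eq_true] at h; have hd : c.dof = 27 * i := (by have := h.1; simp only [cellOK, Bool.and_eq_true, beq_eq_decide, decide_eq_true_eq] at this; exact this.1.1.1.1.2); rw [List.mem_cons] at h₁ h₂; rcases h₁ with e₁ | h₁; (rcases h₂ with e₂ | h₂; (rw [e₁, e₂]); (have := (wf_dof_ge h.2 cl₂ h₂).1; rw [e₁] at he; omega)); (rcases h₂ with e₂ | h₂; (have := (wf_dof_ge h.2 cl₁ h₁).1; rw [e₂] at he; omega); (exact wf_dof_inj h.2 _ h₁ _ h₂ he)))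
/-- every assigned field holds the true shape of its cell -/
def InvA (D : LiftData 11 13) (A : ℕ) : Prop := ∀ c < 121, aAt A (5 * c) = 0 ∨ (1 ≤ D.om (rowOf c) (colOf c) ∧ aAt A (5 * c) = D.gsh (rowOf c) (colOf c) + 1)
/-- the cells still to come are unassigned -/
def Opens (A : ℕ) (cells : List Cell) : Prop := ∀ cl ∈ cells, aAt A (5 * cl.cix) = 0
/-- the true shape of every cell still to come is in its domain -/
def InvD (D : LiftData 11 13) (Dm : ℕ) (cells : List Cell) : Prop := ∀ cl ∈ cells, Dm.testBit (cl.dof + D.gsh (rowOf cl.cix) (colOf cl.cix)) = true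
/-- the cells of well-formed data are big cells of the matrix -/
theorem wf_mem {M : ℕ} : ∀ {i : ℕ} {cells : List Cell}, wfFrom M i cells = true → ∀ cl ∈ cells, cl.cix < 121 ∧ 2 ≤ mAt M cl.cix | _, [], _, cl, h => absurd h (by simp) | i, c :: rest, h, cl, hcl => (by simp only [wfFrom, Bool.and_eq_true] at h; rcases List.mem_cons.1 hcl with rfl | hcl; (have := h.1; simp only [cellOK, Bool.and_eq_true, beq_eq_decide, blt_eq_decide, ble_eq_decide, decide_eq_true_eq] at this; exact ⟨this.1.1.1.1.1.1.1, this.1.1.1.1.1.1.2⟩); (exact wf_mem h.2 cl hcl))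
/-- `sameLine` read back -/
theorem sameLine_true {c c' : ℕ} (h : sameLine c c' = true) : c ≠ c' ∧ (c / 11 = c' / 11 ∨ c % 11 = c' % 11) := by unfold sameLine at h; simp only [Bool.and_eq_true, Bool.not_eq_true', beq_eq_decide, Bool.or_eq_true, decide_eq_true_eq, decide_eq_false_iff_not] at h; exact h
section pairs
variable (D : LiftData 11 13) (hV : D.Valid) (A : ℕ) (hA : InvA D A)
include hV hA
/-- the active columns of a row-pair column list: both cells assigned, not two singletons -/
def act (s s2 : ℕ) : List (ℕ × ℕ) → List ℕ | [] => [] | e :: es => (bif Nat.beq (aAt A e.1) 0 || Nat.beq (aAt A e.2) 0 || Nat.beq (tid (aAt A e.1) (aAt A e.2)) 0 then [] else [e.1 / 5 % 11]) ++ act s s2 es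
omit hV hA in
/-- a singleton cell has shape `0` -/
theorem gsh_eq_zero_of_om {s t : Fin 11} (hV : D.Valid) (h : D.om s t = 1) : D.gsh s t = 0 := by have h1 : 1 ≤ D.om s t := (by omega); have hs := D.sizeOf_gsh hV h1; rw [h] at hs; have hg := (D.shape_spec hV h1).1; have key : ∀ g < 27, Shape13.sizeOf g = 1 → g = 0 := (by decide); exact key _ hg hs
set_option maxHeartbeats 800000 in
/-- **the key of a well-formed ROW pair** is the prime product of the tiles of its active columns, which are distinct, nonempty, not both singletons -/
theorem pairKey_row {s s2 : ℕ} (hs : s < 11) (hs2 : s2 < 11) : ∀ (cols : List (ℕ × ℕ)) (seen : List ℕ), rowPairOK s s2 cols seen = true → pairKey A cols = prodP ((act A s s2 cols).map fun t2 => tid (D.gsh ⟨s, hs⟩ ⟨t2 % 11, Nat.mod_lt _ (by norm_num)⟩ + 1) (D.gsh ⟨s2, hs2⟩ ⟨t2 % 11, Nat.mod_lt _ (by norm_num)⟩ + 1)) ∧ (∀ t2 ∈ act A s s2 cols, t2 < 11 ∧ t2 ∉ seen ∧ 1 ≤ D.om ⟨s, hs⟩ ⟨t2 % 11, Nat.mod_lt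 _ (by norm_num)⟩ ∧ 1 ≤ D.om ⟨s2, hs2⟩ ⟨t2 % 11, Nat.mod_lt _ (by norm_num)⟩ ∧ 2 ≤ D.om ⟨s, hs⟩ ⟨t2 % 11, Nat.mod_lt _ (by norm_num)⟩ * D.om ⟨s2, hs2⟩ ⟨t2 % 11, Nat.mod_lt _ (by norm_num)⟩) ∧ (act A s s2 cols).Nodup | [], seen, _ => (by simp [pairKey, act, prodP]) | e :: es, seen, h => (by simp only [rowPairOK, Bool.and_eq_true, beq_eq_decide, decide_eq_true_eq, Bool.not_eq_true', List.elem_eq_mem, decide_eq_false_iff_not] at h; obtain ⟨⟨⟨he1, he2⟩, hseen⟩, hrec⟩ := h; obtain ⟨ihk, ihm, ihn⟩ := pairKey_row hs hs2 es _ hrec; set t2 := e.1 / 5 % 11 with ht2; have ht2lt : t2 < 11 := Nat.mod_lt _ (by norm_num); have hca : 11 * s + t2 < 121 := (by omega); have hcb : 11 * s2 + t2 < 121 := (by omega); have hra : rowOf (11 * s + t2) = ⟨s, hs⟩ := Fin.ext (by rw [rowOf_val hca]; show (11 * s + t2) / 11 = s; omega); have hrb : rowOf (11 * s2 + t2) =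 ⟨s2, hs2⟩ := Fin.ext (by rw [rowOf_val hcb]; show (11 * s2 + t2) / 11 = s2; omega); have hcola : colOf (11 * s + t2) = ⟨t2 % 11, Nat.mod_lt _ (by norm_num)⟩ := Fin.ext (by show (11 * s + t2) % 11 = t2 % 11; omega); have hcolb : colOf (11 * s2 + t2) = ⟨t2 % 11, Nat.mod_lt _ (by norm_num)⟩ := Fin.ext (by show (11 * s2 + t2) % 11 = t2 % 11; omega); have hAa := hA _ hca; have hAb := hA _ hcb; rw [hra, hcola, ← he1] at hAa; rw [hrb, hcolb, ← he2] at hAb; have hkey : pairKey A (e :: es) = tileP (aAt A e.1) (aAt A e.2) * pairKey A es := rfl; have hact : act A s s2 (e :: es) = (bif Nat.beq (aAt A e.1) 0 || Nat.beq (aAt A e.2) 0 || Nat.beq (tid (aAt A e.1) (aAt A e.2)) 0 then [] else [t2]) ++ act A s s2 es := rfl; have ihm' : ∀ t ∈ act A s s2 es, t < 11 ∧ t ∉ seen ∧ 1 ≤ D.om ⟨s, hs⟩ ⟨t % 11, Nat.mod_lt _ (by norm_num)⟩ ∧ 1 ≤ D.om ⟨s2, hs2⟩ ⟨t % 11, Nat.mod_lt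 _ (by norm_num)⟩ ∧ 2 ≤ D.om ⟨s, hs⟩ ⟨t % 11, Nat.mod_lt _ (by norm_num)⟩ * D.om ⟨s2, hs2⟩ ⟨t % 11, Nat.mod_lt _ (by norm_num)⟩ := (by intro t ht; obtain ⟨h1, h2, h3⟩ := ihm t ht; exact ⟨h1, fun hm => h2 (List.mem_cons_of_mem _ hm), h3⟩); have inactive : tileP (aAt A e.1) (aAt A e.2) = 1 → (Nat.beq (aAt A e.1) 0 || Nat.beq (aAt A e.2) 0 || Nat.beq (tid (aAt A e.1) (aAt A e.2)) 0) = true → pairKey A (e :: es) = prodP ((act A s s2 (e :: es)).map fun t2 => tid (D.gsh ⟨s, hs⟩ ⟨t2 % 11, Nat.mod_lt _ (by norm_num)⟩ + 1) (D.gsh ⟨s2, hs2⟩ ⟨t2 % 11, Nat.mod_lt _ (by norm_num)⟩ + 1)) ∧ (∀ t ∈ act A s s2 (e :: es), t < 11 ∧ t ∉ seen ∧ 1 ≤ D.om ⟨s, hs⟩ ⟨t % 11, Nat.mod_lt _ (by norm_num)⟩ ∧ 1 ≤ D.om ⟨s2, hs2⟩ ⟨t % 11, Nat.mod_lt _ (by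 norm_num)⟩ ∧ 2 ≤ D.om ⟨s, hs⟩ ⟨t % 11, Nat.mod_lt _ (by norm_num)⟩ * D.om ⟨s2, hs2⟩ ⟨t % 11, Nat.mod_lt _ (by norm_num)⟩) ∧ (act A s s2 (e :: es)).Nodup := (by intro htile hcond; rw [hkey, htile, one_mul, hact, hcond]; simp only [cond_true, List.nil_append]; exact ⟨ihk, ihm', ihn⟩); have hb2 : aAt A e.2 < 32 := aAt_lt _ _; have hb1 : aAt A e.1 < 32 := aAt_lt _ _; rcases hAa with hA0 | ⟨hom1, hA1⟩; (refine inactive ?_ (by rw [hA0]; rfl); have hf := tile_facts (a := 0) (b := aAt A e.2) (by norm_num) (by rcases hAb with h | ⟨hom2, h⟩; (rw [h]; norm_num); (rw [h]; have := (D.shape_spec hV hom2).1; omega)); rw [hA0, hf.1, (hf.2.2.1).2 (Or.inl rfl), primeOf_zero]); have hg1 : D.gsh ⟨s, hs⟩ ⟨t2 % 11, Nat.mod_lt _ (by norm_num)⟩ < 27 := (D.shape_spec hV hom1).1; rcases hAb with hB0 | ⟨hom2, hB1⟩; (refine inactive ?_ (by rw [hB0, Bool.or_eq_true]; exact Or.inl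 (by rw [Bool.or_eq_true]; exact Or.inr rfl)); have hf := tile_facts (a := aAt A e.1) (b := 0) (by rw [hA1]; omega) (by norm_num); rw [hB0, hf.1, (hf.2.2.1).2 (Or.inr (Or.inl rfl)), primeOf_zero]); have hg2 : D.gsh ⟨s2, hs2⟩ ⟨t2 % 11, Nat.mod_lt _ (by norm_num)⟩ < 27 := (D.shape_spec hV hom2).1; have hfa := tile_facts (a := aAt A e.1) (b := aAt A e.2) (by rw [hA1]; omega) (by rw [hB1]; omega); by_cases hz : tid (aAt A e.1) (aAt A e.2) = 0; (refine inactive (by rw [hfa.1, hz, primeOf_zero]) ?_; rw [hz]; simp); (have hcond : (Nat.beq (aAt A e.1) 0 || Nat.beq (aAt A e.2) 0 || Nat.beq (tid (aAt A e.1) (aAt A e.2)) 0) = false := (by have h1 : Nat.beq (aAt A e.1) 0 = false := (by rw [hA1]; rfl); have h2 : Nat.beq (aAt A e.2) 0 = false := (by rw [hB1]; rfl); have h3 : Nat.beq (tid (aAt A e.1) (aAt A e.2)) 0 = false := (by rw [beq_eq_decide]; exact decide_eq_false hz); rw [h1, h2, h3]; rfl); rw [hkey, hact, hcond]; simp only [cond_false,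 List.singleton_append, List.map_cons, prodP, List.mem_cons, List.nodup_cons]; refine ⟨by rw [hfa.1, hA1, hB1, ihk], ?_, ?_, ihn⟩; (rintro t (rfl | ht); (refine ⟨ht2lt, hseen, hom1, hom2, ?_⟩; by_contra hlt; have hmul := Nat.mul_le_mul hom1 hom2; have hone : D.om ⟨s, hs⟩ ⟨t2 % 11, Nat.mod_lt _ (by norm_num)⟩ * D.om ⟨s2, hs2⟩ ⟨t2 % 11, Nat.mod_lt _ (by norm_num)⟩ = 1 := (by omega); have h11 := And.intro (Nat.eq_one_of_mul_eq_one_right hone) (Nat.eq_one_of_mul_eq_one_left hone); apply hz; rw [hfa.2.2.1, hA1, hB1, gsh_eq_zero_of_om D hV h11.1, gsh_eq_zero_of_om D hV h11.2]; exact Or.inr (Or.inr ⟨rfl, rfl⟩)); (exact ihm' t ht)); (intro hm; exact (ihm t2 hm).2.1 (List.mem_cons_self ..))))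
end pairs
section cpairs
variable (D : LiftData 11 13) (hV : D.Valid) (A : ℕ) (hA : InvA D A)
include hV hA
/-- the active rows of a column-pair row list -/
def actC : List (ℕ × ℕ) → List ℕ | [] => [] | e :: es => (bif Nat.beq (aAt A e.1) 0 || Nat.beq (aAt A e.2) 0 || Nat.beq (tid (aAt A e.1) (aAt A e.2)) 0 then [] else [e.1 / 5 / 11]) ++ actC es
set_option maxHeartbeats 800000 in
/-- **the key of a well-formed COLUMN pair** is the prime product of the tiles of its active rows, which are distinct, nonempty, not both singletons -/
theorem pairKey_col {t t2 : ℕ} (ht : t < 11) (ht2 : t2 < 11) : ∀ (cols : List (ℕ × ℕ)) (seen : List ℕ), colPairOK t t2 cols seen = true → pairKey A cols = prodP ((actC A cols).map fun s2 => tid (D.gsh ⟨s2 % 11, Nat.mod_lt _ (by norm_num)⟩ ⟨t, ht⟩ + 1) (D.gsh ⟨s2 % 11, Nat.mod_lt _ (by norm_num)⟩ ⟨t2, ht2⟩ + 1)) ∧ (∀ s2 ∈ actC A cols, s2 < 11 ∧ s2 ∉ seen ∧ 1 ≤ D.om ⟨s2 % 11, Nat.mod_lt _ (by norm_num)⟩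 ⟨t, ht⟩ ∧ 1 ≤ D.om ⟨s2 % 11, Nat.mod_lt _ (by norm_num)⟩ ⟨t2, ht2⟩ ∧ 2 ≤ D.om ⟨s2 % 11, Nat.mod_lt _ (by norm_num)⟩ ⟨t, ht⟩ * D.om ⟨s2 % 11, Nat.mod_lt _ (by norm_num)⟩ ⟨t2, ht2⟩) ∧ (actC A cols).Nodup | [], seen, _ => (by simp [pairKey, actC, prodP]) | e :: es, seen, h => (by simp only [colPairOK, Bool.and_eq_true, beq_eq_decide, blt_eq_decide, decide_eq_true_eq, Bool.not_eq_true', List.elem_eq_mem, decide_eq_false_iff_not] at h; obtain ⟨⟨⟨⟨hs2lt, he1⟩, he2⟩, hseen⟩, hrec⟩ := h; obtain ⟨ihk, ihm, ihn⟩ := pairKey_col ht ht2 es _ hrec; set s2 := e.1 / 5 / 11 with hs2; have hca : 11 * s2 + t < 121 := (by omega); have hcb : 11 * s2 + t2 < 121 := (by omega); have hra : rowOf (11 * s2 + t) = ⟨s2 % 11, Nat.mod_lt _ (by norm_num)⟩ := Fin.ext (by rw [rowOf_val hca]; show (11 * s2 + t) / 11 = s2 % 11; omega); have hrb : rowOf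 (11 * s2 + t2) = ⟨s2 % 11, Nat.mod_lt _ (by norm_num)⟩ := Fin.ext (by rw [rowOf_val hcb]; show (11 * s2 + t2) / 11 = s2 % 11; omega); have hcola : colOf (11 * s2 + t) = ⟨t, ht⟩ := Fin.ext (by show (11 * s2 + t) % 11 = t; omega); have hcolb : colOf (11 * s2 + t2) = ⟨t2, ht2⟩ := Fin.ext (by show (11 * s2 + t2) % 11 = t2; omega); have hAa := hA _ hca; have hAb := hA _ hcb; rw [hra, hcola, ← he1] at hAa; rw [hrb, hcolb, ← he2] at hAb; have hkey : pairKey A (e :: es) = tileP (aAt A e.1) (aAt A e.2) * pairKey A es := rfl; have hact : actC A (e :: es) = (bif Nat.beq (aAt A e.1) 0 || Nat.beq (aAt A e.2) 0 || Nat.beq (tid (aAt A e.1) (aAt A e.2)) 0 then [] else [s2]) ++ actC A es := rfl; have ihm' : ∀ u ∈ actC A es, u < 11 ∧ u ∉ seen ∧ 1 ≤ D.om ⟨u % 11, Nat.mod_lt _ (by norm_num)⟩ ⟨t, ht⟩ ∧ 1 ≤ D.om ⟨u % 11, Nat.mod_lt _ (by norm_num)⟩ ⟨t2, ht2⟩ ∧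 2 ≤ D.om ⟨u % 11, Nat.mod_lt _ (by norm_num)⟩ ⟨t, ht⟩ * D.om ⟨u % 11, Nat.mod_lt _ (by norm_num)⟩ ⟨t2, ht2⟩ := (by intro u hu; obtain ⟨h1, h2, h3⟩ := ihm u hu; exact ⟨h1, fun hm => h2 (List.mem_cons_of_mem _ hm), h3⟩); have inactive : tileP (aAt A e.1) (aAt A e.2) = 1 → (Nat.beq (aAt A e.1) 0 || Nat.beq (aAt A e.2) 0 || Nat.beq (tid (aAt A e.1) (aAt A e.2)) 0) = true → pairKey A (e :: es) = prodP ((actC A (e :: es)).map fun s2 => tid (D.gsh ⟨s2 % 11, Nat.mod_lt _ (by norm_num)⟩ ⟨t, ht⟩ + 1) (D.gsh ⟨s2 % 11, Nat.mod_lt _ (by norm_num)⟩ ⟨t2, ht2⟩ + 1)) ∧ (∀ u ∈ actC A (e :: es), u < 11 ∧ u ∉ seen ∧ 1 ≤ D.om ⟨u % 11, Nat.mod_lt _ (by norm_num)⟩ ⟨t, ht⟩ ∧ 1 ≤ D.om ⟨u % 11, Nat.mod_lt _ (by norm_num)⟩ ⟨t2, ht2⟩ ∧ 2 ≤ D.om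 ⟨u % 11, Nat.mod_lt _ (by norm_num)⟩ ⟨t, ht⟩ * D.om ⟨u % 11, Nat.mod_lt _ (by norm_num)⟩ ⟨t2, ht2⟩) ∧ (actC A (e :: es)).Nodup := (by intro htile hcond; rw [hkey, htile, one_mul, hact, hcond]; simp only [cond_true, List.nil_append]; exact ⟨ihk, ihm', ihn⟩); rcases hAa with hA0 | ⟨hom1, hA1⟩; (refine inactive ?_ (by rw [hA0]; rfl); have hf := tile_facts (a := 0) (b := aAt A e.2) (by norm_num) (by rcases hAb with h | ⟨hom2, h⟩; (rw [h]; norm_num); (rw [h]; have := (D.shape_spec hV hom2).1; omega)); rw [hA0, hf.1, (hf.2.2.1).2 (Or.inl rfl), primeOf_zero]); have hg1 : D.gsh ⟨s2 % 11, Nat.mod_lt _ (by norm_num)⟩ ⟨t, ht⟩ < 27 := (D.shape_spec hV hom1).1; rcases hAb with hB0 | ⟨hom2, hB1⟩; (refine inactive ?_ (by rw [hB0, Bool.or_eq_true]; exact Or.inl (by rw [Bool.or_eq_true]; exact Or.inr rfl)); have hf := tile_facts (a := aAt A e.1) (b := 0) (by rw [hA1]; omega) (by norm_num); rw [hB0,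 hf.1, (hf.2.2.1).2 (Or.inr (Or.inl rfl)), primeOf_zero]); have hg2 : D.gsh ⟨s2 % 11, Nat.mod_lt _ (by norm_num)⟩ ⟨t2, ht2⟩ < 27 := (D.shape_spec hV hom2).1; have hfa := tile_facts (a := aAt A e.1) (b := aAt A e.2) (by rw [hA1]; omega) (by rw [hB1]; omega); by_cases hz : tid (aAt A e.1) (aAt A e.2) = 0; (refine inactive (by rw [hfa.1, hz, primeOf_zero]) ?_; rw [hz]; simp); (have hcond : (Nat.beq (aAt A e.1) 0 || Nat.beq (aAt A e.2) 0 || Nat.beq (tid (aAt A e.1) (aAt A e.2)) 0) = false := (by have h1 : Nat.beq (aAt A e.1) 0 = false := (by rw [hA1]; rfl); have h2 : Nat.beq (aAt A e.2) 0 = false := (by rw [hB1]; rfl); have h3 : Nat.beq (tid (aAt A e.1) (aAt A e.2)) 0 = false := (by rw [beq_eq_decide]; exact decide_eq_false hz); rw [h1, h2, h3]; rfl); rw [hkey, hact, hcond]; simp only [cond_false, List.singleton_append, List.map_cons, prodP, List.mem_cons, List.nodup_cons]; refine ⟨by rw [hfa.1, hA1, hB1, ihk], ?_, ?_, ihn⟩;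 (rintro u (rfl | hu); (refine ⟨hs2lt, hseen, hom1, hom2, ?_⟩; by_contra hlt; have hmul := Nat.mul_le_mul hom1 hom2; have hone : D.om ⟨s2 % 11, Nat.mod_lt _ (by norm_num)⟩ ⟨t, ht⟩ * D.om ⟨s2 % 11, Nat.mod_lt _ (by norm_num)⟩ ⟨t2, ht2⟩ = 1 := (by omega); have h11 := And.intro (Nat.eq_one_of_mul_eq_one_right hone) (Nat.eq_one_of_mul_eq_one_left hone); apply hz; rw [hfa.2.2.1, hA1, hB1, gsh_eq_zero_of_om D hV h11.1, gsh_eq_zero_of_om D hV h11.2]; exact Or.inr (Or.inr ⟨rfl, rfl⟩)); (exact ihm' u hu)); (intro hm; exact (ihm s2 hm).2.1 (List.mem_cons_self ..))))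
end cpairs
/-- tile-number lists with equal prime products give the same multiset of tile masks -/
theorem perm_tmask_of_prodP_eq {w ids : List ℕ} (hw : ∀ i ∈ w, 1 ≤ i ∧ i ≤ 314) (hids : ∀ i ∈ ids, 1 ≤ i ∧ i ≤ 314) (h : prodP w = prodP ids) : (w.map tmask).Perm (ids.map tmask) := by rw [prodP_eq, prodP_eq] at h; have hpw : ∀ p ∈ w.map primeOf, Nat.Prime p := (by intro p hp; obtain ⟨i, hi, rfl⟩ := List.mem_map.1 hp; exact (prime_facts (hw i hi).1 (hw i hi).2).1); have hpi : ∀ p ∈ ids.map primeOf, Nat.Prime p := (by intro p hp; obtain ⟨i, hi, rfl⟩ := List.mem_map.1 hp; exact (prime_facts (hids i hi).1 (hids i hi).2).1); have h1 := Nat.primeFactorsList_unique rfl hpw; have h2 := Nat.primeFactorsList_unique h.symm hpi; have hperm : (w.map primeOf).Perm (ids.map primeOf) := h1.trans h2.symm; have hid : ∀ l : List ℕ, (∀ i ∈ l, 1 ≤ i ∧ i ≤ 314) → (l.map primeOf).map idOfPrime = l := (by intro l hl; rw [List.map_map]; (conv_rhs => rw [← List.map_id l]); apply List.map_congr_left;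 intro i hi; exact (prime_facts (hl i hi).1 (hl i hi).2).2); have : w.Perm ids := (by have := hperm.map idOfPrime; rwa [hid w hw, hid ids hids] at this); exact this.map tmask
/-- a SOUND leaf test: on a complete assignment holding the true shapes of a valid `D`, it does not claim a refutation -/
def LeafSound (D : LiftData 11 13) (leaf : ℕ → ℕ → Bool) : Prop := ∀ A Dm : ℕ, InvA D A → leaf A Dm = true → False
/-- the trivial leaf test is sound -/
theorem leafSound_noLeaf (D : LiftData 11 13) : LeafSound D noLeaf := fun _ _ _ h => Bool.false_ne_true h
set_option maxHeartbeats 1600000 in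
/-- **SOUNDNESS OF THE SHAPE SEARCH**: along well-formed data with verified tables, a valid `D` satisfying the invariant refutes `searchK leaf = true` for every sound leaf test. -/
theorem searchK_sound (D : LiftData 11 13) (hV : D.Valid) {M : ℕ} (hM : MatOK M D) {leaf : ℕ → ℕ → Bool} (hleaf : LeafSound D leaf) : ∀ (cells : List Cell) (i A Dm : ℕ), wfFrom M i cells = true → tablesOK cells = true → InvA D A → Opens A cells → InvD D Dm cells → searchK leaf cells A Dm = true → False | [], _, _, _, _, _, hIA, _, _, h => hleaf _ _ hIA h | cl :: rest, i, A, Dm, hwf, htab, hIA, hop, hID, h => (by have hwf0 := hwf; simp only [wfFrom, Bool.and_eq_true] at hwf; obtain ⟨hcell, hwf'⟩ := hwf; have hcell0 := hcell; simp only [cellOK, Bool.and_eq_true, beq_eq_decide, blt_eq_decide, ble_eq_decide, decide_eq_true_eq, Bool.not_eq_true', List.elem_eq_mem, decide_eq_false_iff_not, List.all_eq_true] at hcell; obtain ⟨⟨⟨⟨⟨⟨⟨hc, hm2⟩, hm4⟩, hdof⟩, hnotin⟩, hcands⟩, hechk⟩, hpairs⟩ := hcell; set c := cl.cix with hcdef;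 set s := rowOf c; set t := colOf c; have hom : D.om s t = mAt M c := hM.omC hc; have hom1 : 1 ≤ D.om s t := (by omega); set g := D.gsh s t with hgdef; have hg27 : g < 27 := (D.shape_spec hV hom1).1; have hgmem : g ∈ idsOfSize (mAt M c) := (by rw [← hom]; exact D.gsh_mem_idsOfSize hV hom1); simp only [candsOK, Bool.and_eq_true, List.all_eq_true, beq_eq_decide, decide_eq_true_eq] at hcands; obtain ⟨hcl, hprod⟩ := hcands; have hclist : cl.cands = (idsOfSize (mAt M c)).map fun g => (2 ^ g, Nat.shiftLeft (g + 1) (5 * c), confl g) := (by simpa using hcl); have hmem : (2 ^ g, Nat.shiftLeft (g + 1) (5 * c), confl g) ∈ cl.cands := (by rw [hclist]; exact List.mem_map.2 ⟨g, hgmem, rfl⟩); have hDg : Dm.testBit (cl.dof + g) = true := hID cl (List.mem_cons_self ..); have hpres : Nat.beq (Nat.land (dAt Dm cl.dof) (2 ^ g)) 0 = false := (by rw [beq_land_two_pow, testBit_dAt]; simp [hg27, hDg]); have hchild := children_child h hmem hpres; unfold child afterFilter at hchild; simp only at hchild; set A' := Nat.lor A (Nat.shiftLeft (g + 1) (5 *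 c)) with hA'; set D' := Nat.xor Dm (Nat.land Dm (confl g * cl.nmul)) with hD'; have hIA' : InvA D A' := (by intro c0 hc0; by_cases e : c0 = c; (rw [e]; right; refine ⟨hom1, ?_⟩; rw [hA', aAt_lor_shiftLeft_self (by omega) (hop cl (List.mem_cons_self ..))]); (rw [hA', aAt_lor_shiftLeft_of_ne (by omega) (by omega)]; exact hIA c0 hc0)); have hop' : Opens A' rest := (by intro cl' hcl'; have hne : cl'.cix ≠ c := fun e => hnotin (e ▸ List.mem_map.2 ⟨cl', hcl', rfl⟩); rw [hA', aAt_lor_shiftLeft_of_ne (by omega) (by omega)]; exact hop cl' (List.mem_cons_of_mem _ hcl')); have hID' : InvD D D' rest := (by intro cl' hcl'; rw [hD', testBit_clr, hID cl' (List.mem_cons_of_mem _ hcl'), Bool.true_and]; rw [hprod g hgmem]; cases hbit : (lineMask (confl g) c rest).testBit (cl'.dof + D.gsh (rowOf cl'.cix) (colOf cl'.cix)); (rfl); (exfalso; obtain ⟨cl'', hmem'', hline, hle, hcg⟩ := testBit_lineMask hbit; have hg'27 : D.gsh (rowOf cl'.cix) (colOf cl'.cix) < 27 := (by obtain ⟨hc',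 hm'⟩ := wf_mem hwf' cl' hcl'; exact (D.shape_spec hV (by rw [hM.omC hc']; omega)).1); have hlt27 : cl'.dof + D.gsh (rowOf cl'.cix) (colOf cl'.cix) - cl''.dof < 27 := (by by_contra hge; rw [← bit_eq, bit_confl_ge _ _ (by omega)] at hcg; exact Bool.false_ne_true hcg); obtain ⟨-, ⟨a, ha⟩⟩ := wf_dof_ge hwf' cl' hcl'; obtain ⟨-, ⟨b, hb⟩⟩ := wf_dof_ge hwf' cl'' hmem''; have hdd : cl''.dof = cl'.dof := (by omega); have hsame := wf_dof_inj hwf' cl'' hmem'' cl' hcl' hdd; rw [hsame] at hline; rw [hsame, show cl'.dof + D.gsh (rowOf cl'.cix) (colOf cl'.cix) - cl'.dof = D.gsh (rowOf cl'.cix) (colOf cl'.cix) by omega] at hcg; obtain ⟨hne, hrc⟩ := sameLine_true hline; obtain ⟨hc', hm'⟩ := wf_mem hwf' cl' hcl'; have hom1' : 1 ≤ D.om (rowOf cl'.cix) (colOf cl'.cix) := (by rw [hM.omC hc']; omega); rcases hrc with hrow | hcol; (have hreq : rowOf cl'.cix = s := Fin.ext (by rw [rowOf_val hc', rowOf_val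 hc]; exact hrow.symm); have htne : t ≠ colOf cl'.cix := (by intro e; apply hne; exact ((show c = 11 * (rowOf c : ℕ) + (colOf c : ℕ) from (cix_eq hc).symm).trans ((show 11 * (rowOf c : ℕ) + (colOf c : ℕ) = 11 * (rowOf cl'.cix : ℕ) + (colOf cl'.cix : ℕ) by rw [hreq, ← e]).trans (show 11 * (rowOf cl'.cix : ℕ) + (colOf cl'.cix : ℕ) = cl'.cix from cix_eq hc')))); have := D.row_compat hV htne hom1 (hreq ▸ hom1'); rw [bit_eq] at this; rw [hreq] at hcg; exact Bool.false_ne_true (this.symm.trans hcg)); (have hceq : colOf cl'.cix = t := Fin.ext hcol.symm; have hsne : s ≠ rowOf cl'.cix := (by intro e; apply hne; exact ((show c = 11 * (rowOf c : ℕ) + (colOf c : ℕ) from (cix_eq hc).symm).trans ((show 11 * (rowOf c : ℕ) + (colOf c : ℕ) = 11 * (rowOf cl'.cix : ℕ) + (colOf cl'.cix : ℕ) by rw [hceq, ← e]).trans (show 11 * (rowOf cl'.cix : ℕ) + (colOf cl'.cix : ℕ) = cl'.cix from cix_eq hc')))); have := D.col_compat hV hsne hom1 (hceq ▸ hom1');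 rw [bit_eq] at this; rw [hceq] at hcg; exact Bool.false_ne_true (this.symm.trans hcg)))); cases hempty : anyEmpty D' cl.echk; (rw [hempty] at hchild; simp only [cond_false] at hchild; cases hbad : badPair A' cl.pairs; (rw [hbad] at hchild; simp only [cond_false] at hchild; exact searchK_sound D hV hM hleaf rest (i + 1) A' D' hwf' (by simp only [tablesOK, Bool.and_eq_true] at htab; exact htab.2) hIA' hop' hID' hchild); (obtain ⟨pr, hpr, hhit⟩ := badPair_true hbad; have hinf := tablesOK_mem htab (List.mem_cons_self ..) hpr; obtain ⟨w, hw⟩ := KT.all_mem hinf hhit; simp only [Bool.and_eq_true, List.all_eq_true, ble_eq_decide, beq_eq_decide, decide_eq_true_eq, Bool.not_eq_true'] at hw; obtain ⟨⟨hwr, hwk⟩, hwp⟩ := hw; have hwr' : ∀ i ∈ w, 1 ≤ i ∧ i ≤ 314 := fun i hi => hwr i hi; have hpo := hpairs pr hpr; unfold pairOK at hpo; rw [Bool.or_eq_true, List.any_eq_true, List.any_eq_true] at hpo; rcases hpo with ⟨s2, hs2m, hs2⟩ | ⟨t2, ht2m, ht2⟩; (rw [List.mem_range] at hs2m; simp only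 [Bool.and_eq_true, Bool.not_eq_true', beq_eq_decide, decide_eq_false_iff_not] at hs2; obtain ⟨hs2ne, hrp⟩ := hs2; have hs11 : c / 11 < 11 := (by omega); obtain ⟨hk, hmm, hnd⟩ := pairKey_row D hV A' hIA' hs11 hs2m pr.1 [] hrp; set ids := (act A' (c / 11) s2 pr.1).map fun t2 => tid (D.gsh ⟨c / 11, hs11⟩ ⟨t2 % 11, Nat.mod_lt _ (by norm_num)⟩ + 1) (D.gsh ⟨s2, hs2m⟩ ⟨t2 % 11, Nat.mod_lt _ (by norm_num)⟩ + 1) with hids; have hidsr : ∀ j ∈ ids, 1 ≤ j ∧ j ≤ 314 := (by intro j hj; obtain ⟨t2, ht2, rfl⟩ := List.mem_map.1 hj; obtain ⟨-, -, ho1, ho2, hprod2⟩ := hmm t2 ht2; have hf := tile_facts (a := D.gsh ⟨c / 11, hs11⟩ ⟨t2 % 11, _⟩ + 1) (b := D.gsh ⟨s2, hs2m⟩ ⟨t2 % 11, _⟩ + 1) (by have := (D.shape_spec hV ho1).1; omega) (by have := (D.shape_spec hV ho2).1; omega); refine ⟨Nat.one_le_iff_ne_zero.2 fun hz => ?_,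 hf.2.1⟩; rcases (hf.2.2.1).1 hz with h0 | h0 | ⟨h0, h0'⟩; (omega); (omega); (have e1 : D.gsh ⟨c / 11, hs11⟩ ⟨t2 % 11, Nat.mod_lt _ (by norm_num)⟩ = 0 := (by omega); have e2 : D.gsh ⟨s2, hs2m⟩ ⟨t2 % 11, Nat.mod_lt _ (by norm_num)⟩ = 0 := (by omega); have hz1 := D.sizeOf_gsh hV ho1; have hz2 := D.sizeOf_gsh hV ho2; rw [e1] at hz1; rw [e2] at hz2; have hs0 : Shape13.sizeOf 0 = 1 := (by decide); rw [← hz1, ← hz2, hs0] at hprod2; exact absurd hprod2 (by norm_num))); have hperm := perm_tmask_of_prodP_eq hwr' hidsr (hwk.trans hk); set ts : List (Fin 11) := (act A' (c / 11) s2 pr.1).map fun t2 => ⟨t2 % 11, Nat.mod_lt _ (by norm_num)⟩ with hts; have htsnd : ts.Nodup := (by rw [hts]; refine hnd.map_on fun a ha b hb e => ?_; have h1 := (hmm a ha).1; have h2 := (hmm b hb).1; have := congrArg Fin.val e; dsimp only at this; rw [Nat.mod_eq_of_lt h1, Nat.mod_eq_of_lt h2] at this; exact this); have hpk := D.row_pack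 hV (s := ⟨c / 11, hs11⟩) (s' := ⟨s2, hs2m⟩) (fun e => hs2ne (congrArg Fin.val e).symm) ts htsnd (by intro u hu; rw [hts] at hu; obtain ⟨t2, ht2, rfl⟩ := List.mem_map.1 hu; obtain ⟨-, -, ho1, ho2, hprod2⟩ := hmm t2 ht2; exact ⟨ho1, ho2, hprod2⟩); have hmaps : ts.map (fun u => tmask (tid (D.gsh ⟨c / 11, hs11⟩ u + 1) (D.gsh ⟨s2, hs2m⟩ u + 1))) = ids.map tmask := (by rw [hts, hids, List.map_map, List.map_map]; rfl); rw [hmaps] at hpk; have := packDFS_of_packP (hpk.perm hperm.symm); rw [hwp] at this; exact Bool.false_ne_true this); (rw [List.mem_range] at ht2m; simp only [Bool.and_eq_true, Bool.not_eq_true', beq_eq_decide, decide_eq_false_iff_not] at ht2; obtain ⟨ht2ne, hcp⟩ := ht2; have ht11 : c % 11 < 11 := Nat.mod_lt _ (by norm_num); obtain ⟨hk, hmm, hnd⟩ := pairKey_col D hV A' hIA' ht11 ht2m pr.1 [] hcp; set ids := (actC A' pr.1).map fun s2 => tid (D.gsh ⟨s2 % 11, Nat.mod_lt _ (by norm_num)⟩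 ⟨c % 11, ht11⟩ + 1) (D.gsh ⟨s2 % 11, Nat.mod_lt _ (by norm_num)⟩ ⟨t2, ht2m⟩ + 1) with hids; have hidsr : ∀ j ∈ ids, 1 ≤ j ∧ j ≤ 314 := (by intro j hj; obtain ⟨s2, hs2, rfl⟩ := List.mem_map.1 hj; obtain ⟨-, -, ho1, ho2, hprod2⟩ := hmm s2 hs2; have hf := tile_facts (a := D.gsh ⟨s2 % 11, _⟩ ⟨c % 11, ht11⟩ + 1) (b := D.gsh ⟨s2 % 11, _⟩ ⟨t2, ht2m⟩ + 1) (by have := (D.shape_spec hV ho1).1; omega) (by have := (D.shape_spec hV ho2).1; omega); refine ⟨Nat.one_le_iff_ne_zero.2 fun hz => ?_, hf.2.1⟩; rcases (hf.2.2.1).1 hz with h0 | h0 | ⟨h0, h0'⟩; (omega); (omega); (have e1 : D.gsh ⟨s2 % 11, Nat.mod_lt _ (by norm_num)⟩ ⟨c % 11, ht11⟩ = 0 := (by omega); have e2 : D.gsh ⟨s2 % 11, Nat.mod_lt _ (by norm_num)⟩ ⟨t2, ht2m⟩ = 0 := (by omega); have hz1 := D.sizeOf_gsh hV ho1; have hz2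 := D.sizeOf_gsh hV ho2; rw [e1] at hz1; rw [e2] at hz2; have hs0 : Shape13.sizeOf 0 = 1 := (by decide); rw [← hz1, ← hz2, hs0] at hprod2; exact absurd hprod2 (by norm_num))); have hperm := perm_tmask_of_prodP_eq hwr' hidsr (hwk.trans hk); set ss : List (Fin 11) := (actC A' pr.1).map fun s2 => ⟨s2 % 11, Nat.mod_lt _ (by norm_num)⟩ with hss; have hssnd : ss.Nodup := (by rw [hss]; refine hnd.map_on fun a ha b hb e => ?_; have h1 := (hmm a ha).1; have h2 := (hmm b hb).1; have := congrArg Fin.val e; dsimp only at this; rw [Nat.mod_eq_of_lt h1, Nat.mod_eq_of_lt h2] at this; exact this); have hpk := D.col_pack hV (t := ⟨c % 11, ht11⟩) (t' := ⟨t2, ht2m⟩) (fun e => ht2ne (congrArg Fin.val e).symm) ss hssnd (by intro u hu; rw [hss] at hu; obtain ⟨s2, hs2, rfl⟩ := List.mem_map.1 hu; obtain ⟨-, -, ho1, ho2, hprod2⟩ := hmm s2 hs2; exact ⟨ho1, ho2, hprod2⟩); have hmaps : ss.map (fun u => tmask (tid (D.gsh u ⟨c % 11, ht11⟩ + 1)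 (D.gsh u ⟨t2, ht2m⟩ + 1))) = ids.map tmask := (by rw [hss, hids, List.map_map, List.map_map]; rfl); rw [hmaps] at hpk; have := packDFS_of_packP (hpk.perm hperm.symm); rw [hwp] at this; exact Bool.false_ne_true this))); (obtain ⟨o, ho, hzero⟩ := anyEmpty_true hempty; obtain ⟨cl', hcl', hdo⟩ : ∃ cl' ∈ rest, cl'.dof = o := (by have := hechk o ho; simpa using this); have hbit := hID' cl' hcl'; obtain ⟨hc', hm'⟩ := wf_mem hwf' cl' hcl'; have hg'27 : D.gsh (rowOf cl'.cix) (colOf cl'.cix) < 27 := (D.shape_spec hV (by rw [hM.omC hc']; omega)).1; rw [← hdo] at hzero; rw [(dAt_eq_zero_iff D' cl'.dof).1 hzero _ hg'27] at hbit; exact Bool.false_ne_true hbit))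
/-- the initial assignment marks exactly the singleton cells -/
def a0OK (M A0 : ℕ) : Bool := allLT (fun c => Nat.beq (aAt A0 (5 * c)) (bif Nat.beq (mAt M c) 1 then 1 else 0)) 121
/-- the initial domains contain every shape of the cell's size, except possibly at the WLOG position `w` -/
def d0OK (M D0 w : ℕ) (cells : List Cell) : Bool := cells.all fun cl => Nat.beq cl.dof (27 * w) || (idsOfSize (mAt M cl.cix)).all fun g => bit D0 (cl.dof + g)
/-- the orbit matrix of `D` is the literal `M` (decidable reading of `MatOK`) -/
theorem matOK_iff (M : ℕ) (D : LiftData 11 13) : MatOK M D ↔ ∀ s t : Fin 11, D.om s t = mAt M (11 * s + t) := ⟨fun h s t => (h s t).symm, fun h s t => (h s t).symm⟩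
/-- **what a class run proves.** If the data are well formed for `M`, the tables verify, the initial assignment marks the singletons, the initial domains are full except at the WLOG position `w`, and the run succeeds, then NO valid lift data has orbit matrix `M` and its WLOG cell's shape in the WLOG domain. -/
theorem noLift_of_searchK {M w : ℕ} {cells : List Cell} {A0 D0 : ℕ} {leaf : ℕ → ℕ → Bool} (hwf : wfFrom M 0 cells = true) (htab : tablesOK cells = true) (hA0 : a0OK M A0 = true) (hD0 : d0OK M D0 w cells = true) (hrun : searchK leaf cells A0 D0 = true) (D : LiftData 11 13) (hV : D.Valid) (hM : MatOK M D) (hleaf : LeafSound D leaf) (hw : ∀ cl ∈ cells, cl.dof = 27 * w → D0.testBit (cl.dof + D.gsh (rowOf cl.cix) (colOf cl.cix)) = true) : False := by refine searchK_sound D hV hM hleaf cells 0 A0 D0 hwf htab ?_ ?_ ?_ hrun; (intro c hc; have := allLT_iff.1 hA0 c hc; rw [beq_eq_decide, decide_eq_true_eq] at this; rw [this]; cases h1 : Nat.beq (mAt M c) 1; (exact Or.inl rfl); (right; rw [beq_eq_decide, decide_eq_true_eq] at h1; have hom : D.om (rowOf c) (colOf c) = 1 := (by rw [hM.omC hc,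 h1]); exact ⟨by omega, by rw [gsh_eq_zero_of_om D hV hom]; rfl⟩)); (intro cl hcl; obtain ⟨hc, hm⟩ := wf_mem hwf cl hcl; have := allLT_iff.1 hA0 cl.cix hc; rw [beq_eq_decide, decide_eq_true_eq] at this; rw [this]; have : Nat.beq (mAt M cl.cix) 1 = false := (by rw [beq_eq_decide]; exact decide_eq_false (by omega)); rw [this]; rfl); (intro cl hcl; simp only [d0OK, List.all_eq_true, Bool.or_eq_true, beq_eq_decide, decide_eq_true_eq] at hD0; rcases hD0 cl hcl with hwl | hall; (exact hw cl hcl hwl); (obtain ⟨hc, hm⟩ := wf_mem hwf cl hcl; have hom1 : 1 ≤ D.om (rowOf cl.cix) (colOf cl.cix) := (by rw [hM.omC hc]; omega); have := hall _ (by rw [← hM.omC hc]; exact D.gsh_mem_idsOfSize hV hom1); rwa [bit_eq] at this))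
/-- **what a class run proves** (plain shape search, trivial leaf): no valid lift data has orbit matrix `M` and its WLOG cell's shape in the WLOG domain. -/
theorem noLift_of_search {M w : ℕ} {cells : List Cell} {A0 D0 : ℕ} (hwf : wfFrom M 0 cells = true) (htab : tablesOK cells = true) (hA0 : a0OK M A0 = true) (hD0 : d0OK M D0 w cells = true) (hrun : search cells A0 D0 = true) (D : LiftData 11 13) (hV : D.Valid) (hM : MatOK M D) (hw : ∀ cl ∈ cells, cl.dof = 27 * w → D0.testBit (cl.dof + D.gsh (rowOf cl.cix) (colOf cl.cix)) = true) : False := noLift_of_searchK hwf htab hA0 hD0 hrun D hV hM (leafSound_noLeaf D) hw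
/-- the multiplier-orbit representatives of the shapes of each size (pairs: `{0,1}`; triples: ids `7`, `9`; planar 4-sets: id `23`) -/
def repsOf : ℕ → List ℕ | 2 => [1] | 3 => [7, 9] | 4 => [23] | _ => [0]
/-- the WLOG cell: a cell of the data at position `w` has index `cw`, and the initial domain there contains the representatives `reps` -/
def wlogOK (cells : List Cell) (D0 w cw : ℕ) (reps : List ℕ) : Bool := cells.any (fun cl => Nat.beq cl.dof (27 * w) && Nat.beq cl.cix cw) && reps.all fun g => bit D0 (27 * w + g)
/-- discharging the WLOG hypothesis of `noLift_of_search` from `wlogOK` and the shape of the WLOG cell -/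
theorem wlog_of_wlogOK {M w cw : ℕ} {cells : List Cell} {D0 : ℕ} {reps : List ℕ} (hwf : wfFrom M 0 cells = true) (h : wlogOK cells D0 w cw reps = true) (D : LiftData 11 13) (hg : D.gsh (rowOf cw) (colOf cw) ∈ reps) : ∀ cl ∈ cells, cl.dof = 27 * w → D0.testBit (cl.dof + D.gsh (rowOf cl.cix) (colOf cl.cix)) = true := by simp only [wlogOK, Bool.and_eq_true, List.any_eq_true, List.all_eq_true, beq_eq_decide, decide_eq_true_eq, bit_eq] at h; obtain ⟨⟨W, hW, hWd, hWc⟩, hbits⟩ := h; intro cl hcl hd; have := wf_dof_inj hwf cl hcl W hW (hd.trans hWd.symm); subst this; rw [hd, hWc]; exact hbits _ hg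

end Shape13

end Summit.Ventures.DiscreteObjects.PP12
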